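/-
Copyright (c) 2026 the pub-hodgecm-mathlib formalisation cell (harness21).  Prover seat hodgecm-mathlib-R90-C10-p01 (g4), R90-TF SLAB section S1 «Ch10-local» (base
R90-C10), h413 = `stmt-HodgeConjecture-24833`; U4 :182 wild socket (S-W), cells (S-W-Ra)∕(S-W-Rb); card (c5) of the (S-W) line lead R90-C10-p05 (g3) (R-SW-4,
2026-09-05T04:00:33Z): «THE WILD TYPE-VECTOR TWIN» — ★ (B-1a) `K2E3BranchATypeVectorTwoDepth.exists_typeVector_twoDepth` with its tame θ-letters (`hcond hcondF ht hvt h1–h4`)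
replaced by the ONE letter they feed, `hθmul` (θ multiplicative on `J_e`).  KERNEL module: THEOREMS ONLY (no definition, no named fact, no `sorry`, no instance, no notation).  2026-09-05.
-/
import Summits.HodgeConjecture.HodgeConjecture.Theorems.K2E3BranchATypeVectorTwoDepth   -- ★ (B-1a) p863411 (K2E3-p34 (g2)): the tame original (its body is re-run here with step `e3` fed the letter `hθmul`); brings ★ V1 `K2E3IntertwiningKernelOfReducible`, ★ p862547 `K2E3IwahoriTwoDepthLettersCM`, ★ Z2A-2 `K2E3IwahoriDatumDilation`, ★ V2b `K2E3TypeVectorOfSubrepFactored`, ★ `K2E3BranchATypeLettersCM`, ★ (B3) `levelGroup_le_iwahori`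
import HarnessLib

/-!
# R90-TF · S1 (Rogawski 1990 Ch. 12, local) — (c5) `R90S1WildTypeVectorTwoDepth`: the `(J_e, θ)`-type vector of a reducible `i(χ₁, 1)`, given ONLY that `θ` is multiplicative on `J_e` — the wild-ready twin of ★ (B-1a)

Cell hodgecm-mathlib, slab R90-TF (director brief v2), section S1 «Ch10-local» (base R90-C10), crux h413 = stmt-HodgeConjecture-24833 (lane `--supports … --as helper`),
route `route-HodgeConjecture-HCCMUnconditional` (no route verbs).  U4 :182 wild socket (S-W); card (c5) of the (S-W) line lead R90-C10-p05 (g3) (R-SW-4: «wild TYPE-VECTOR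
twin = ★ (B-1a) with `(ht)(hvt)(h2)(h3)` ↦ defect letters over ★ (W-0b); census first: list every use of `hvt` inside (B-1a); if it is only `theta_mul_concave`, the twin is S»).
THEOREMS ONLY (no `def`, no `instance`, no notation, no named fact, no `sorry`); ★-only imports.

CENSUS (the ten-line answer, recorded here): in ★ (B-1a) `exists_typeVector_twoDepth` (TREE :98–:180) the letters `hcond hcondF ht hvt h1 h2 h3 h4 hkm` enter at EXACTLY ONE
point — step `e3` (:168–:169), as the arguments of ★ p862709 `theta_mul_concave`, producing the `hθmul` input of ★ V2b `K2E3TypeVectorOfSubrepFactored.exists_typeVector_of_mem_of_factored`;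
★ V1 (the `G`-stable `V ∋ f` killed by every `Λ_g`, from `hred`), ★ p862547 (the Iwahori datum with `K 0 = J_e`), ★ Z2A-2 (dilation), ★ `theta_eq_tau_of_mem` ∕ `theta_eq_one_of_map_mem`
(the other two V2b letters) and the final `obtain` use NONE of them.  So the honest wild twin is not «`hvt ↦ hδ`» but «the nine θ-letters ↦ the ONE letter `hθmul`» — the SAME
binder shape as ★ (B-1′) `exists_normalised_typeBasis_twoDepth_of_normChar_eq_one`'s `hθmul` (:111–:114) — which every regime discharges BY NAME: tame ★ `theta_mul_concave`
(integral `t`), wild (R-b) ★ (W-0b) `R90S1WildConcaveLevelMinOfRecord.theta_mul_concave_min` ∕ ★ (W-3b) over the minimal `t` (★ (W-0) + ★ bridge p865207, `|t| = e^{d−1}`), wild (R-a)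
★ p865222 `theta_mul_of_fixTrivial_of_defect`.  The twin is therefore S-sized, PLACE-FREE and DATUM-FREE, and STRICTLY MORE GENERAL than ★ (B-1a) (which is its instance at
`hθmul := theta_mul_concave …`; not restated here — DEDUP).
* **`exists_typeVector_twoDepth_of_thetaMul (h10 h20) (hns) (χ₁ h₁ hnu hcontr) (hθmul) (w₀ hw₀) (μ) (hred)`** ⊢ ★ (B-1a)'s conclusion VERBATIM: `∃ f′`, `(J_e, θ)`-eigen, `f′(1) ≠ 0`,
  `∫_N f′(w₀ n g) dμ = 0` for every `g` — in particular the `hT` letter of ★-to-be (W-8) `R90S1WildPairEntriesEndAssembly` (`g ∈ {1, w₀}`).  Body = ★ (B-1a)'s, token for token,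
  with step `e3 := e2 hθmul`.
CONSUMERS: (W-8) `R90S1WildPairEntriesEndAssembly.{false_of_typeLetters_of_bigCell_zero, exists_root_of_typeLetters_of_pairEntries}` (`hT`), at `e_Rb = (⌊n∕2⌋, δ; ⌈n∕2⌉, δ+1)` and
`e_Ra` (R-S1-50), with `hθmul` from the ★ wild θ-files; the tame leaf could equally call it with ★ `theta_mul_concave`.

HONEST LABEL.  HC_CM is proved only modulo the 7 printed citations (2 remaining named inputs: hLiu418 = stmt-HodgeConjecture-24832, h413 = stmt-HodgeConjecture-24833) until
rung 0 closes; count-neutral INFRASTRUCTURE — pays NO socket; (S-W-Ra)∕(S-W-Rb) OPEN (cover∕witness twins (c1)–(c3), gap cell (c4), P-WILD-1 open), (S-W-A) XL; :182 ∕ C :88∕:98 ∕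
A2′ OPEN; REL ≠ ★ ≠ BUILT.

## References
* [Keys1984] D. Keys, *Principal series representations of special unitary groups over local fields*, Compositio Math. 51 (1984), §3, §7 Thm (2) p. 126.
* [Roche1998] A. Roche, *Types and Hecke algebras for principal series representations of split reductive p-adic groups*, Ann. Sci. ÉNS (4) 31 (1998), §3.
* [Casselman1995] W. Casselman, *Introduction to the theory of admissible representations of `p`-adic reductive groups* (1995), §6.3–§6.4.
* [MoyPrasad1996] A. Moy, G. Prasad, *Jacquet functors and unrefined minimal K-types*, Comment. Math. Helv. 71 (1996), §3.
* [BruhatTits1972] F. Bruhat, J. Tits, Publ. Math. IHÉS 41 (1972), (4.4.4), (6.4.9).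
-/

set_option autoImplicit false
-- the mandated namespace has the single-problem summit's repeated segment (`HodgeConjecture.HodgeConjecture`)
set_option linter.dupNamespace false

noncomputable section

open NumberField IsDedekindDomain MeasureTheory
open scoped Matrix MatrixGroups WithZero Valued
open Literature.NumberTheory Literature.NumberTheory.Automorphic Literature.NumberTheory.Automorphic.UnitaryGroup
open Literature.NumberTheory.Rogawski1990

namespace Summit.HodgeConjecture.HodgeConjecture.R90.S1.WildTypeVectorTwoDepth

open Summit.HodgeConjecture.HodgeConjecture.Cruxes.H413
open Summit.HodgeConjecture.HodgeConjecture.Cruxes.H413.K2E3BranchATypeLettersCM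
open Summit.HodgeConjecture.HodgeConjecture.Cruxes.H413.K2E3ConcaveLevelIwahoriCharacterCM
open Summit.HodgeConjecture.HodgeConjecture.Cruxes.H413.K2E3BranchAIrreducibleTwoDepth
open Summit.HodgeConjecture.HodgeConjecture.Cruxes.H413.K2E3BranchATypeVectorTwoDepth

variable (L : Type) [Field L] [NumberField L] [IsCMField L] (v : HeightOneSpectrum (𝓞 ↥(maximalRealSubfield L)))
  (w : PlacesOver L v) (hw : IsCMField.complexConj L • w.1 = w.1)
  (eA : Gqs L v ≃ₜ* ↥(unitaryGroupOfForm (galAdicCompletionMap (L := L) (IsCMField.complexConj L) hw) ((StdForm.antidiagonal 3).over (w.1.adicCompletion L))))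
  (heA : ∀ g : Gqs L v,
    ((eA g : ↥(unitaryGroupOfForm (galAdicCompletionMap (L := L) (IsCMField.complexConj L) hw) ((StdForm.antidiagonal 3).over (w.1.adicCompletion L)))) :
        GL (Fin 3) (w.1.adicCompletion L)) =
      ((localNonsplitEquiv (IsCMField.complexConj L) (qsForm L) (IsCMField.complexConj_ne_one L) w hw g :
        ↥(unitaryGroupOfForm (galAdicCompletionMap (L := L) (IsCMField.complexConj L) hw) (placeForm (qsForm L) w.1))) : GL (Fin 3) (w.1.adicCompletion L)))
  {ϖ : w.1.adicCompletion L} (hϖ : Valued.v ϖ = WithZero.exp (-1 : ℤ))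
  (g₁ : GL (Fin 3) (w.1.adicCompletion L)) (hg₁ : (g₁ : Matrix (Fin 3) (Fin 3) (w.1.adicCompletion L)) = Matrix.diagonal ![(1 : w.1.adicCompletion L), 1, ϖ])
  (K0 K1 I : Subgroup (Gqs L v))
  (hK0 : K0 = ((glInt 3 (w.1.adicCompletion L)).subgroupOf
    (unitaryGroupOfForm (galAdicCompletionMap (L := L) (IsCMField.complexConj L) hw) ((StdForm.antidiagonal 3).over (w.1.adicCompletion L)))).comap
      eA.toMulEquiv.toMonoidHom)
  (hK1 : K1 = (((glInt 3 (w.1.adicCompletion L)).map (MulAut.conj g₁).toMonoidHom).subgroupOf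
    (unitaryGroupOfForm (galAdicCompletionMap (L := L) (IsCMField.complexConj L) hw) ((StdForm.antidiagonal 3).over (w.1.adicCompletion L)))).comap
      eA.toMulEquiv.toMonoidHom)
  (hI : I = K0 ⊓ K1)
  (r₁ s₁ r₂ s₂ : ℕ)
  (Jg : Subgroup ↥(unitaryGroupOfForm (galAdicCompletionMap (L := L) (IsCMField.complexConj L) hw) ((StdForm.antidiagonal 3).over (w.1.adicCompletion L))))
  (hJg : ∀ k : ↥(unitaryGroupOfForm (galAdicCompletionMap (L := L) (IsCMField.complexConj L) hw) ((StdForm.antidiagonal 3).over (w.1.adicCompletion L))),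
    k ∈ Jg ↔ ∀ i j, Valued.v (((k : GL (Fin 3) (w.1.adicCompletion L)) : Matrix (Fin 3) (Fin 3) (w.1.adicCompletion L)) i j) ≤
      Valued.v ϖ ^ (![![0, r₁, s₁], ![r₂, 0, r₁], ![s₂, r₂, 0]] : Fin 3 → Fin 3 → ℕ) i j)
  (Je : Subgroup (Gqs L v)) (hJe : Je = Jg.comap eA.toMulEquiv.toMonoidHom)
/-! ## The `(J_e, θ)`-type vector of a reducible `i(χ₁, 1)` from the ONE letter `hθmul` -/

open Classical in
include hw heA hϖ hg₁ hK0 hK1 hI hJg hJe in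
set_option maxHeartbeats 4000000 in
set_option synthInstance.maxHeartbeats 400000 in
-- ★ (B-1a)'s measured class VERBATIM (staged applications of ★ Z2A-2 ∕ ★ V2b on the `SmoothInd` carrier; unstaged they time out)
/-- **(c5) THE `(J_e, θ)`-TYPE VECTOR OF A REDUCIBLE `i(χ₁, 1)`, θ-MULTIPLICATIVITY AS THE ONLY θ-LETTER** (wild-ready twin of ★ (B-1a) `exists_typeVector_twoDepth`).  Frame: `v`
non-split (`hns`), `w ∣ v`, `eA`, a uniformiser `ϖ`, `g₁`, `K₀`, `K₁`, `I`; `Je = eA⁻¹(Jg)`, `e = (0 r₁ s₁; r₂ 0 r₁; s₂ r₂ 0)` with `1 ≤ r₂`, `1 ≤ s₂` (so `J_e ≤ I`, ★ (B3)).  Letters: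
`χ₁` continuous, non-unitary, contracting; **`hθmul` — `θ(xy) = θ(x)θ(y)` on `J_e`** for `θ(g) = χ₁(g₀₀)` (if a unit, else `0`), in ★ (B-1′)'s binder shape; `w₀` of matrix `Φ₃`; a
Haar measure `μ` on `N(L⁺_v)`; `i(χ₁, 1)` REDUCIBLE (`hred`).  Then there is `f′` in the induced model with `b · f′ = θ(b) f′` on `J_e`, `f′(1) ≠ 0`, and `∫_N f′(w₀ n g) dμ = 0` for
EVERY `g` — ★ (B-1a)'s conclusion VERBATIM.  Proof = ★ (B-1a)'s body token for token (★ V1 → ★ p862547 → ★ Z2A-2 → ★ V2b) with its step `e3` fed `hθmul` instead of ★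
`theta_mul_concave hcond hcondF ht hvt h1 h2 h3 h4` — the ONLY place those nine tame letters entered.  At a wild place `hθmul` := ★ (W-0b) `theta_mul_concave_min` ∕ ★ (W-3b) ∕ ★
p865222 over the minimal trace-one `t` (★ (W-0), `|t| = e^{d−1}` ★ p865207); NO `|t| ≤ 1`, NO `|2|_w = 1`, NO datum.
[cite: Casselman1995, §6.4] [cite: Roche1998, §3] [cite: MoyPrasad1996, §3] [cite: Keys1984, §3, §7 Thm (2)] [cite: BruhatTits1972, (6.4.9)] -/
theorem exists_typeVector_twoDepth_of_thetaMul (h10 : 1 ≤ r₂) (h20 : 1 ≤ s₂)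
    (hns : ∀ w' : PlacesOver L v, IsCMField.complexConj L • w'.1 = w'.1)
    (χ₁ : (LocalRing L v)ˣ →* ℂˣ) (h₁ : Continuous fun x => ((χ₁ x : ℂˣ) : ℂ)) (hnu : ∃ x, ‖((χ₁ x : ℂˣ) : ℂ)‖ ≠ 1)
    (hcontr : ∀ x : (LocalRing L v)ˣ, unitModulusChar (LocalRing L v) x < 1 → ‖((χ₁ x : ℂˣ) : ℂ)‖ < 1)
    -- THE ONE LETTER: `θ` is multiplicative on `J_e` (★ (B-1′)'s `hθmul` binder shape VERBATIM; tame: ★ `theta_mul_concave`; wild: ★ (W-0b) `theta_mul_concave_min` ∕ ★ (W-3b) ∕ ★ p865222)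
    (hθmul : ∀ x ∈ Je, ∀ y ∈ Je,
      (if h : IsUnit ((((x * y : Gqs L v).val : GL (Fin 3) (LocalRing L v)) : Matrix (Fin 3) (Fin 3) (LocalRing L v)) 0 0) then ((χ₁ h.unit : ℂˣ) : ℂ) else 0) =
        (if h : IsUnit (((x.val : GL (Fin 3) (LocalRing L v)) : Matrix (Fin 3) (Fin 3) (LocalRing L v)) 0 0) then ((χ₁ h.unit : ℂˣ) : ℂ) else 0) *
          (if h : IsUnit (((y.val : GL (Fin 3) (LocalRing L v)) : Matrix (Fin 3) (Fin 3) (LocalRing L v)) 0 0) then ((χ₁ h.unit : ℂˣ) : ℂ) else 0))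
    (w₀ : ↥(unitaryGroupOfForm (conjLocal L (IsCMField.complexConj L) v) (cmLocalForm L 3 v))) (hw₀ : Units.val (w₀ : GL (Fin 3) (LocalRing L v)) = cmLocalForm L 3 v)
    [MeasurableSpace ↥(cmBorelTriple L 3 v).N] [BorelSpace ↥(cmBorelTriple L 3 v).N] (μ : Measure ↥(cmBorelTriple L 3 v).N) [μ.IsHaarMeasure]
    (hred : ∃ N : Subrepresentation (cmPrincipalSeries L 3 v (cmTorusCharPair L v χ₁ 1)), N ≠ ⊥ ∧ N ≠ ⊤) :
    haveI := locallyCompactSpace_cmBorelU L 3 v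
    ∃ f' : Representation.SmoothInd (cmBorelTriple L 3 v).P
        (Representation.twist (((Representation.trivial ℂ ↥(torusU (conjLocal L (IsCMField.complexConj L) v) (cmLocalForm L 3 v)) ℂ).twist
          (cmTorusCharPair L v χ₁ 1)).comp (cmBorelTriple L 3 v).proj) (rootDeltaChar (cmBorelTriple L 3 v).P)),
      (∀ x ∈ Je, Representation.smoothIndRep _ _ x f' =
        (if h : IsUnit (((x.val : GL (Fin 3) (LocalRing L v)) : Matrix (Fin 3) (Fin 3) (LocalRing L v)) 0 0) then ((χ₁ h.unit : ℂˣ) : ℂ) else 0) • f') ∧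
      f'.toFun 1 ≠ 0 ∧
      ∀ g : ↥(unitaryGroupOfForm (conjLocal L (IsCMField.complexConj L) v) (cmLocalForm L 3 v)),
        ∫ n : ↥(cmBorelTriple L 3 v).N, f'.toFun (w₀ * (n : ↥(unitaryGroupOfForm (conjLocal L (IsCMField.complexConj L) v) (cmLocalForm L 3 v))) * g) ∂μ = 0 := by
  haveI := locallyCompactSpace_cmBorelU L 3 v
  -- the exponent matrix `e = (0 r₁ s₁; r₂ 0 r₁; s₂ r₂ 0)`: zero diagonal, anti-transpose symmetric
  have he0 : ∀ i : Fin 3, (![![0, r₁, s₁], ![r₂, 0, r₁], ![s₂, r₂, 0]] : Fin 3 → Fin 3 → ℕ) i i = 0 := fun i => by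
    fin_cases i <;> rfl
  have hsym : ∀ i j : Fin 3, (![![0, r₁, s₁], ![r₂, 0, r₁], ![s₂, r₂, 0]] : Fin 3 → Fin 3 → ℕ) (Fin.rev j) (Fin.rev i) =
      (![![0, r₁, s₁], ![r₂, 0, r₁], ![s₂, r₂, 0]] : Fin 3 → Fin 3 → ℕ) i j := fun i j => by
    fin_cases i <;> fin_cases j <;> rfl
  -- ★ p863311 §1: `J_e ≤ I`
  have hJI : Je ≤ I := levelGroup_le_iwahori L v w hw eA hϖ g₁ hg₁ K0 K1 I hK0 hK1 hI r₁ s₁ r₂ s₂ Jg hJg Je hJe h10 h20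
  -- ★ V1: a `G`-stable `V ∋ f`, `f(1) ≠ 0`, killed by the intertwining functional `Λ_{w₀}`
  have h₂ : Continuous fun x : ↥(normOneUnits (conjLocal L (IsCMField.complexConj L) v)) =>
      (((1 : ↥(normOneUnits (conjLocal L (IsCMField.complexConj L) v)) →* ℂˣ) x : ℂˣ) : ℂ) := by
    simp only [MonoidHom.one_apply]; exact continuous_const
  obtain ⟨V, f, hfV, hf1, hΛ⟩ : ∃ (V : Subrepresentation (Representation.smoothIndRep (cmBorelTriple L 3 v).P
      (Representation.twist
      (((Representation.trivial ℂ ↥(torusU (conjLocal L (IsCMField.complexConj L) v) (cmLocalForm L 3 v)) ℂ).twist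
        (cmTorusCharPair L v χ₁ 1)).comp (cmBorelTriple L 3 v).proj) (rootDeltaChar (cmBorelTriple L 3 v).P))))
      (f : Representation.SmoothInd (cmBorelTriple L 3 v).P
      (Representation.twist
      (((Representation.trivial ℂ ↥(torusU (conjLocal L (IsCMField.complexConj L) v) (cmLocalForm L 3 v)) ℂ).twist
        (cmTorusCharPair L v χ₁ 1)).comp (cmBorelTriple L 3 v).proj) (rootDeltaChar (cmBorelTriple L 3 v).P))),
      f ∈ V ∧ f.toFun 1 ≠ 0 ∧ ∀ f', f' ∈ V → ∀ g : ↥(unitaryGroupOfForm (conjLocal L (IsCMField.complexConj L) v) (cmLocalForm L 3 v)),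
        ∫ n : ↥(cmBorelTriple L 3 v).N, f'.toFun (w₀ * (n : ↥(unitaryGroupOfForm (conjLocal L (IsCMField.complexConj L) v) (cmLocalForm L 3 v))) * g) ∂μ = 0 :=
    K2E3IntertwiningKernelOfReducible.exists_section_apply_one_ne_zero_forall_intertwiningIntegral_eq_zero L v hns χ₁ 1 h₁ h₂ hnu hcontr hred w₀ hw₀ μ
  -- ★ p862547: the Iwahori datum with `K 0 = J_e`, `K 1 = I`, `N̄ = eA⁻¹(N̄_w)`
  obtain ⟨𝓘, hK0J, -, hNbar⟩ := K2E3IwahoriTwoDepthLettersCM.exists_iwahoriDatum_K_zero_eq_levelGroup L v w hw eA heA hϖ g₁ hg₁ K0 K1 I hK0 hK1 hI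
    _ Jg hJg Je hJe he0 hsym h10 h20
  subst hK0J
  -- ★ Z2A-2 at level `0`: a dilate of `f` inside `V`, non-zero at `1`, fixed by `J_e ∩ N̄` — the application is STAGED (`@`-explicit carrier and inducing character, one
  -- argument per `have`; ★ d0B `K2E3TypeVectorInKernelDepthZeroCM`'s measured pattern: in one piece the ★ Z2A-5 class costs minutes of unification, staged seconds)
  have d0 := @K2E3IwahoriDatumDilation.exists_dilate_typeReady ↥(unitaryGroupOfForm (conjLocal L (IsCMField.complexConj L) v) (cmLocalForm L 3 v)) _ _ _ (cmBorelTriple L 3 v).P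
    (Representation.twist (((Representation.trivial ℂ ↥(torusU (conjLocal L (IsCMField.complexConj L) v) (cmLocalForm L 3 v)) ℂ).twist
          (cmTorusCharPair L v χ₁ 1)).comp (cmBorelTriple L 3 v).proj) (rootDeltaChar (cmBorelTriple L 3 v).P))
    (cmBorelTriple L 3 v) 𝓘
  have d1 := d0 (cmBorelTriple L 3 v).M_le
  have d2 := d1 V
  have d3 := d2 f
  have d4 := d3 hfV
  have d5 := d4 hf1 0
  obtain ⟨i, hf₁V, hf₁1, hf₁fix⟩ := d5
  -- ★ V2b: the `(J_e, θ)`-type vector in `V` (staged likewise; `hθmul` = THE LETTER, `hθH` = ★ `theta_eq_tau_of_mem` via §1, `hθC` = ★ `theta_eq_one_of_map_mem`)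
  have e0 := @K2E3TypeVectorOfSubrepFactored.exists_typeVector_of_mem_of_factored ↥(unitaryGroupOfForm (conjLocal L (IsCMField.complexConj L) v) (cmLocalForm L 3 v)) _ _ _ (cmBorelTriple L 3 v).P
    (Representation.twist (((Representation.trivial ℂ ↥(torusU (conjLocal L (IsCMField.complexConj L) v) (cmLocalForm L 3 v)) ℂ).twist
          (cmTorusCharPair L v χ₁ 1)).comp (cmBorelTriple L 3 v).proj) (rootDeltaChar (cmBorelTriple L 3 v).P))
    (𝓘.K 0) (𝓘.K 0 ⊓ 𝓘.Nbar) (𝓘.isCompact_K 0)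
  have e1 := e0 (fun b hb => exists_mem_P_mul_of_mem _ 𝓘 0 hb)
  have e2 := e1 (fun g : ↥(unitaryGroupOfForm (conjLocal L (IsCMField.complexConj L) v) (cmLocalForm L 3 v)) =>
    if h : IsUnit (((g : GL (Fin 3) (LocalRing L v)) : Matrix (Fin 3) (Fin 3) (LocalRing L v)) 0 0) then ((χ₁ h.unit : ℂˣ) : ℂ) else 0)
  have e3 := e2 (fun x hx y hy => hθmul x hx y hy)
  have e4 := e3 (fun p hp hpI => theta_eq_tau_of_mem L v w hw eA heA hϖ g₁ hg₁ K0 K1 I hK0 hK1 hI χ₁ p hp (hJI hpI))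
  have e5 := e4 (fun c hc _ => theta_eq_one_of_map_mem L v w hw eA heA χ₁ (by
      have h := (Subgroup.mem_inf.1 hc).2
      rw [hNbar] at h
      exact h))
  have e6 := e5 V
  have e7 := e6 _ hf₁V
  have e8 := e7 hf₁1
  have e9 := e8 (fun c hc _ => hf₁fix c hc)
  obtain ⟨f', hf'V, hf'1, heig⟩ := e9
  exact ⟨f', heig, hf'1, fun g => hΛ f' hf'V g⟩

end Summit.HodgeConjecture.HodgeConjecture.R90.S1.WildTypeVectorTwoDepth

end
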